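import Mathlib
import Summits.NavierStokesRegularity.NavierStokesRegularity.Theorems.SubOnsagerCeilingVirtualFloorFaces
import Summits.NavierStokesRegularity.NavierStokesRegularity.Theorems.SubOnsagerCeilingVirtualFloorGame
import HarnessLib

/-!
# Ω-COUPLED FOUR-SHELL WINDOWS with a GENERAL FACE FAMILY (curved faces), bounded form
(helper file for crux stmt-NavierStokesRegularity-27057 `SubOnsagerCeiling.ForwardTailCeilingKP`, `--supports … --as helper`;
LEAD SOC g9, census v12 §J, line «kp-shell-barrier»)

`window4_le_of_coupledCertB` (p680792) proves «every window `(Yₙ,…,Yₙ₊₃)` of the rescaled chain stays in `Ω`» for regions `Ω` cut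
out by LINEAR facets and three cubic floors. LEAD g8's numerics (census v11 §I.7–I.8) left one obstruction for such polytopes at
`b = 3/2`: the sliver `x₁ ≈ c` where the minimal safe floor is steep in `x₁` and gentle-but-convex in `x₂` — a job for faces CURVED
in `(x₁, x₂)` (recommendation §I.8). This file is the coupled scheme for an ARBITRARY finite family of continuous faces
`g k : (Fin 4 → ℝ) → ℝ` with user-supplied partial derivatives `dg k i` and a right-sided chain rule (`hchain`, the hypothesis shape
of `game_of_faceCert`, p672306): region `Ω = {x : 0 ≤ xᵢ, ∀ k, g k x ≤ 0}`; hypotheses `hInit` (`[0,δ₀]⁴ ⊂ Ω`), `hSafe`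
(`Ω ⊂ {x₃ ≤ c}`), and per active face — for all `x ∈ Ω`, feeds `v` and drains `z` with `(v,x₀,x₁,x₂) ∈ Ω`, `(x₁,x₂,x₃,z) ∈ Ω`
and `x, v, z ≤ c` — the strict INERTIAL inequality `Σᵢ dg k i x · Φᵢ < 0` along the coupled field
`Φ = (v² − p x₀x₁, L(x₀² − p x₁x₂), L²(x₁² − p x₂x₃), L³(x₂² − p x₃ z))` and the DAMPING sign condition
`0 ≤ Σᵢ dg k i x · b2ⁱ xᵢ`. Conclusion: every shell `≤ c`. Proof = the sibling's simultaneous first-exit argument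
(`forall_le_of_hasDerivWithinAt_Ici_of_active_lt`, p670150) over (window `n ≤ K`) × (face `k`); adapted from
`SubOnsagerCeilingVirtualFloorWindow4B.lean`, with the facet/floor case analysis replaced by the chain rule.
Polynomial faces are certified face by face in the kernel with `SubOnsagerCeilingVirtualFloorKernelFace{,Coupled}` (p687184,
p687873). No numerical certificate is proved here. MODEL lattice; nothing here bears on Navier–Stokes regularity; 27057 stays OPEN.
[cite: BarbatoMorandinRomito2011, §2 Lemma 2.1] [cite: Hartman2002, Ch. III §4 Cor 4.1]
-/

noncomputable section

-- the sub-problem namespace `NavierStokesRegularity.NavierStokesRegularity` is the tree's layout (D-0017)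
set_option linter.dupNamespace false

namespace Summit.NavierStokesRegularity.NavierStokesRegularity.Theorems.VirtualFloor

open Set Filter Topology

/-- The window vector `(a, b, c, d)` as a point of `Fin 4 → ℝ`. [folklore] -/
def vec4 (a b c d : ℝ) : Fin 4 → ℝ := ![a, b, c, d]

/-- Component `0` of `vec4`. [folklore] -/
@[simp] theorem vec4_zero (a b c d : ℝ) : vec4 a b c d 0 = a := rfl
/-- Component `1` of `vec4`. [folklore] -/
@[simp] theorem vec4_one (a b c d : ℝ) : vec4 a b c d 1 = b := rfl
/-- Component `2` of `vec4`. [folklore] -/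
@[simp] theorem vec4_two (a b c d : ℝ) : vec4 a b c d 2 = c := rfl
/-- Component `3` of `vec4`. [folklore] -/
@[simp] theorem vec4_three (a b c d : ℝ) : vec4 a b c d 3 = d := rfl

set_option maxHeartbeats 800000 in
/-- **Ω-coupled four-shell windows with a general face family, bounded form.** Rescaled chain
`Ẏₙ = -κₙYₙ + Fₙ(Y²ₙ₋₁ - pYₙYₙ₊₁)` (`Fₙ₊₁ = L Fₙ > 0`, `κₙ₊₁ = b2·κₙ ≥ 0`), three vanishing bottom shells, non-negative shells,
data `≤ δ₀`, quiescent tail `Yₙ ≤ δ₀` for `n ≥ K+1`. Faces `g k` (finite family) with partial derivatives `dg k i`, continuity and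
the right-sided chain rule; `Ω = {x ≥ 0, ∀ k, g k x ≤ 0}` contains `[0,δ₀]⁴` and lies in `{x₃ ≤ c}`; every ACTIVE face satisfies,
for all states of `Ω` with neighbour windows in `Ω` and `x, v, z ≤ c`, the strict inertial inequality along the coupled field
and the damping sign condition. Then every shell stays `≤ c`. MODEL-lattice ODE lemma.
[cite: BarbatoMorandinRomito2011, §2 Lemma 2.1] -/
theorem window4_le_of_coupledFaceCertB {ι : Type*} [Finite ι] {Y : ℕ → ℝ → ℝ} {κ F : ℕ → ℝ}
    {L p s δ₀ b2 c : ℝ} {K : ℕ} {g : ι → (Fin 4 → ℝ) → ℝ} {dg : ι → Fin 4 → (Fin 4 → ℝ) → ℝ}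
    (hs : 0 < s) (hκ : ∀ n, 0 ≤ κ n) (hκg : ∀ n, κ (n + 1) = b2 * κ n) (hF : ∀ n, 0 < F n)
    (hFL : ∀ n, F (n + 1) = L * F n)
    (hcontg : ∀ k, Continuous (g k))
    (hchain : ∀ k (X : ℝ → Fin 4 → ℝ) (X' : Fin 4 → ℝ) (S : Set ℝ) (t : ℝ),
      (∀ i, HasDerivWithinAt (fun r => X r i) (X' i) S t) →
      HasDerivWithinAt (fun r => g k (X r)) (∑ i, dg k i (X t) * X' i) S t)
    (hInit : ∀ x : Fin 4 → ℝ, (∀ i, 0 ≤ x i) → (∀ i, x i ≤ δ₀) → ∀ k, g k x ≤ 0)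
    (hSafe : ∀ x : Fin 4 → ℝ, (∀ i, 0 ≤ x i) → (∀ k, g k x ≤ 0) → x 3 ≤ c)
    (hFace : ∀ k (x : Fin 4 → ℝ) (v z : ℝ), (∀ i, 0 ≤ x i) → 0 ≤ v → 0 ≤ z → (∀ i, x i ≤ c) → v ≤ c → z ≤ c →
      (∀ k', g k' x ≤ 0) → (∀ k', g k' (vec4 v (x 0) (x 1) (x 2)) ≤ 0) → (∀ k', g k' (vec4 (x 1) (x 2) (x 3) z) ≤ 0) →
      g k x = 0 →
      (dg k 0 x * (v ^ 2 - p * x 0 * x 1) + dg k 1 x * (L * (x 0 ^ 2 - p * x 1 * x 2)) +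
          dg k 2 x * (L ^ 2 * (x 1 ^ 2 - p * x 2 * x 3)) + dg k 3 x * (L ^ 3 * (x 2 ^ 2 - p * x 3 * z)) < 0) ∧
      0 ≤ dg k 0 x * x 0 + dg k 1 x * (b2 * x 1) + dg k 2 x * (b2 ^ 2 * x 2) + dg k 3 x * (b2 ^ 3 * x 3))
    (hYz : ∀ n, n ≤ 2 → ∀ t, Y n t = 0)
    (hcont : ∀ n, ContinuousOn (Y n) (Icc 0 s))
    (hderiv : ∀ n, 1 ≤ n → ∀ t ∈ Ico 0 s, HasDerivWithinAt (Y n)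
      (-κ n * Y n t + F n * (Y (n - 1) t ^ 2 - p * Y n t * Y (n + 1) t)) (Ici t) t)
    (hpos : ∀ n, ∀ t ∈ Icc 0 s, 0 ≤ Y n t)
    (hinit : ∀ n, Y n 0 ≤ δ₀)
    (htail : ∀ n, K + 1 ≤ n → ∀ t ∈ Icc 0 s, Y n t ≤ δ₀) :
    ∀ n, ∀ t ∈ Icc 0 s, Y n t ≤ c := by
  -- the window of shell `n` at time `t`
  set W : ℕ → ℝ → Fin 4 → ℝ := fun n t => vec4 (Y n t) (Y (n + 1) t) (Y (n + 2) t) (Y (n + 3) t) with hW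
  have hWi : ∀ n t, W n t 0 = Y n t ∧ W n t 1 = Y (n + 1) t ∧ W n t 2 = Y (n + 2) t ∧ W n t 3 = Y (n + 3) t :=
    fun n t => ⟨rfl, rfl, rfl, rfl⟩
  have hWnn : ∀ n, ∀ t ∈ Icc (0:ℝ) s, ∀ i, 0 ≤ W n t i := by
    intro n t ht i
    fin_cases i
    · exact hpos _ t ht
    · exact hpos _ t ht
    · exact hpos _ t ht
    · exact hpos _ t ht
  set InΩ : (Fin 4 → ℝ) → Prop := fun x => (∀ i, 0 ≤ x i) ∧ ∀ k, g k x ≤ 0 with hInΩ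
  have hδ0 : 0 ≤ δ₀ := (hYz 0 (by norm_num) 0).symm.le.trans (hinit 0)
  have hδc : δ₀ ≤ c := by
    have := hSafe (vec4 δ₀ δ₀ δ₀ δ₀) (fun i => by fin_cases i <;> exact hδ0)
      (hInit _ (fun i => by fin_cases i <;> exact hδ0) (fun i => by fin_cases i <;> exact le_rfl))
    simpa using this
  set DY : ℕ → ℝ → ℝ := fun n t =>
    if n = 0 then 0 else -κ n * Y n t + F n * (Y (n - 1) t ^ 2 - p * Y n t * Y (n + 1) t) with hDY
  have hDer : ∀ n, ∀ t ∈ Ico 0 s, HasDerivWithinAt (Y n) (DY n t) (Ici t) t := by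
    intro n t ht
    rcases Nat.eq_zero_or_pos n with rfl | hn
    · have h0 : Y 0 = fun _ => 0 := funext (hYz 0 (by norm_num))
      rw [h0]; simp only [hDY, if_true]; exact hasDerivWithinAt_const t (Ici t) 0
    · have := hderiv n hn t ht
      simp only [hDY, if_neg (Nat.pos_iff_ne_zero.mp hn)]; exact this
  have hrate : ∀ n i, F (n + i) = F n * L ^ i := fun n i => rate_shift hFL n i
  have hdamp : ∀ n i, κ (n + i) = κ n * b2 ^ i := fun n i => rate_shift hκg n i
  set fd : ℕ → ℝ → ℝ := fun n t => if n = 0 then 0 else Y (n - 1) t with hfd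
  have hfd0 : ∀ n t, t ∈ Icc (0:ℝ) s → 0 ≤ fd n t := by
    intro n t ht; simp only [hfd]; split_ifs
    · exact le_rfl
    · exact hpos _ t ht
  have hDYgame : ∀ n (i : ℕ) t, t ∈ Ico (0:ℝ) s → i ≤ 3 →
      DY (n + i) t = -(κ n * b2 ^ i) * Y (n + i) t + F n * L ^ i *
        ((if i = 0 then fd n t else Y (n + i - 1) t) ^ 2 - p * Y (n + i) t * Y (n + i + 1) t) := by
    intro n i t ht hi
    by_cases hni : n + i = 0
    · have hn0 : n = 0 := by omega
      have hi0' : i = 0 := by omega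
      subst hn0; subst hi0'
      simp only [hDY, hfd, Nat.add_zero, if_true]
      rw [hYz 0 (by norm_num) t]; ring
    · simp only [hDY, if_neg hni]
      rw [hrate n i, hdamp n i]
      have e1 : (if i = 0 then fd n t else Y (n + i - 1) t) = Y (n + i - 1) t := by
        split_ifs with hi0'
        · subst hi0'; simp only [hfd, Nat.add_zero]; rw [if_neg (by omega)]
        · rfl
      rw [e1]
  -- the window derivative vector
  set DW : ℕ → ℝ → Fin 4 → ℝ := fun n t => vec4 (DY n t) (DY (n + 1) t) (DY (n + 2) t) (DY (n + 3) t) with hDW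
  have hWder : ∀ n, ∀ t ∈ Ico (0:ℝ) s, ∀ i, HasDerivWithinAt (fun r => W n r i) (DW n t i) (Ici t) t := by
    intro n t ht i
    fin_cases i
    · exact hDer n t ht
    · exact hDer (n + 1) t ht
    · exact hDer (n + 2) t ht
    · exact hDer (n + 3) t ht
  -- the faces: (window `n ≤ K`) × (face `k`)
  set h : (Fin (K + 1) × ι) → ℝ → ℝ := fun nk t => g nk.2 (W nk.1 t) with hh
  set h' : (Fin (K + 1) × ι) → ℝ → ℝ := fun nk t => ∑ i, dg nk.2 i (W nk.1 t) * DW nk.1 t i with hh'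
  have hcontW : ∀ n, ContinuousOn (fun t => W n t) (Icc 0 s) := by
    intro n
    refine continuousOn_pi.2 fun i => ?_
    fin_cases i
    · exact hcont n
    · exact hcont (n + 1)
    · exact hcont (n + 2)
    · exact hcont (n + 3)
  have hcontF : ∀ nk, ContinuousOn (h nk) (Icc 0 s) := by
    rintro ⟨n, k⟩
    exact (hcontg k).comp_continuousOn (hcontW n)
  have hderF : ∀ nk, ∀ t ∈ Ico 0 s, HasDerivWithinAt (h nk) (h' nk t) (Ici t) t := by
    rintro ⟨n, k⟩ t ht
    exact hchain k (W n) (DW n t) (Ici t) t (hWder n t ht)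
  have hwin : ∀ t ∈ Icc 0 s, ∀ n : Fin (K + 1), (∀ k, h (n, k) t ≤ 0) → InΩ (W n t) := by
    intro t ht n hall
    exact ⟨hWnn n t ht, fun k => hall k⟩
  have hbox : ∀ x : Fin 4 → ℝ, (∀ i, 0 ≤ x i) → (∀ i, x i ≤ δ₀) → InΩ x :=
    fun x hx hx' => ⟨hx, hInit x hx hx'⟩
  have hwinN : ∀ t ∈ Icc 0 s, (∀ nk, h nk t ≤ 0) → ∀ n : ℕ, InΩ (W n t) := by
    intro t ht hall n
    by_cases hn : n ≤ K
    · exact hwin t ht ⟨n, Nat.lt_succ_of_le hn⟩ (fun k => hall (⟨n, Nat.lt_succ_of_le hn⟩, k))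
    · push Not at hn
      refine hbox _ (hWnn n t ht) fun i => ?_
      fin_cases i
      · exact htail _ (by omega) t ht
      · exact htail _ (by omega) t ht
      · exact htail _ (by omega) t ht
      · exact htail _ (by omega) t ht
  -- the window below shell `n` (feed `fd n t` in slot 0)
  have hbelow : ∀ t ∈ Icc 0 s, (∀ nk, h nk t ≤ 0) → ∀ n : ℕ,
      InΩ (vec4 (fd n t) (Y n t) (Y (n + 1) t) (Y (n + 2) t)) := by
    intro t ht hall n
    rcases Nat.eq_zero_or_pos n with rfl | hn
    · simp only [hfd, if_true]
      rw [hYz 0 (by norm_num) t, hYz 1 (by norm_num) t, hYz 2 (by norm_num) t]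
      exact hbox _ (fun i => by fin_cases i <;> exact le_rfl) (fun i => by fin_cases i <;> exact hδ0)
    · simp only [hfd, if_neg (Nat.pos_iff_ne_zero.mp hn)]
      have := hwinN t ht hall (n - 1)
      simp only [hW] at this
      rwa [show n - 1 + 1 = n by omega, show n - 1 + 2 = n + 1 by omega, show n - 1 + 3 = n + 2 by omega] at this
  -- every shell is `≤ c` while all windows are in `Ω`
  have hYc : ∀ t ∈ Icc 0 s, (∀ nk, h nk t ≤ 0) → ∀ j : ℕ, Y j t ≤ c := by
    intro t ht hall j
    rcases lt_or_ge j 3 with hj | hj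
    · rw [hYz j (by omega) t]; exact hδ0.trans hδc
    · obtain ⟨k, rfl⟩ : ∃ k, j = k + 3 := ⟨j - 3, by omega⟩
      obtain ⟨hnn, hg⟩ := hwinN t ht hall k
      exact hSafe _ hnn hg
  have hfdc : ∀ t ∈ Icc 0 s, (∀ nk, h nk t ≤ 0) → ∀ n : ℕ, fd n t ≤ c := by
    intro t ht hall n; simp only [hfd]; split_ifs
    · exact hδ0.trans hδc
    · exact hYc t ht hall _
  -- the strict active-face condition
  have hface : ∀ t ∈ Ico 0 s, (∀ nk, h nk t ≤ (fun _ => (0:ℝ)) nk) → ∀ nk, h nk t = (fun _ => (0:ℝ)) nk →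
      h' nk t < 0 := by
    intro t ht hall nk hk
    have htI : t ∈ Icc 0 s := Ico_subset_Icc_self ht
    obtain ⟨n, k⟩ := nk
    obtain ⟨hxnn, hxg⟩ := hwinN t htI hall n
    obtain ⟨-, hgB⟩ := hbelow t htI hall n
    obtain ⟨-, hgA⟩ := hwinN t htI hall (n + 1)
    have hxc : ∀ i, W n t i ≤ c := by
      intro i
      fin_cases i
      · exact hYc t htI hall n
      · exact hYc t htI hall (n + 1)
      · exact hYc t htI hall (n + 2)
      · exact hYc t htI hall (n + 3)
    have hcv := hfdc t htI hall n
    have hcz := hYc t htI hall (n + 4)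
    have hv0 := hfd0 n t htI
    have hz0 := hpos (n + 4) t htI
    have hA : ∀ k', g k' (vec4 (W n t 1) (W n t 2) (W n t 3) (Y (n + 4) t)) ≤ 0 := by
      intro k'
      have := hgA k'
      simp only [hW] at this ⊢
      rwa [show (n:ℕ) + 1 + 1 = n + 2 by omega, show (n:ℕ) + 1 + 2 = n + 3 by omega,
        show (n:ℕ) + 1 + 3 = n + 4 by omega] at this
    have hB : ∀ k', g k' (vec4 (fd n t) (W n t 0) (W n t 1) (W n t 2)) ≤ 0 := by
      intro k'; simpa [hW] using hgB k'
    have hk0 : g k (W n t) = 0 := hk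
    obtain ⟨hQ, hSt⟩ := hFace k (W n t) (fd n t) (Y (n + 4) t) hxnn hv0 hz0 hxc hcv hcz hxg hB hA hk0
    -- the game form of the four derivatives
    have hFn : 0 < F n := hF n
    have hκn : 0 ≤ κ n := hκ n
    have e0 := hDYgame n 0 t ht (by norm_num)
    have e1 := hDYgame n 1 t ht (by norm_num)
    have e2 := hDYgame n 2 t ht (by norm_num)
    have e3 := hDYgame n 3 t ht (by norm_num)
    simp only [Nat.add_zero, pow_zero, mul_one, if_true, show (1:ℕ) ≠ 0 from one_ne_zero,
      show (2:ℕ) ≠ 0 from two_ne_zero, show (3:ℕ) ≠ 0 from by norm_num, if_false, pow_one,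
      show (n:ℕ) + 1 - 1 = n by omega, show (n:ℕ) + 2 - 1 = n + 1 by omega, show (n:ℕ) + 3 - 1 = n + 2 by omega,
      show (n:ℕ) + 1 + 1 = n + 2 by omega, show (n:ℕ) + 2 + 1 = n + 3 by omega,
      show (n:ℕ) + 3 + 1 = n + 4 by omega] at e0 e1 e2 e3
    change ∑ i, dg k i (W n t) * DW n t i < 0
    rw [Fin.sum_univ_four]
    simp only [hDW, vec4_zero, vec4_one, vec4_two, vec4_three]
    rw [e0, e1, e2, e3]
    simp only [hW, vec4_zero, vec4_one, vec4_two, vec4_three] at hQ hSt ⊢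
    have key : dg k 0 (vec4 (Y n t) (Y (n + 1) t) (Y (n + 2) t) (Y (n + 3) t)) *
          (-κ n * Y n t + F n * (fd n t ^ 2 - p * Y n t * Y (n + 1) t)) +
        dg k 1 (vec4 (Y n t) (Y (n + 1) t) (Y (n + 2) t) (Y (n + 3) t)) *
          (-(κ n * b2) * Y (n + 1) t + F n * L * (Y n t ^ 2 - p * Y (n + 1) t * Y (n + 2) t)) +
        dg k 2 (vec4 (Y n t) (Y (n + 1) t) (Y (n + 2) t) (Y (n + 3) t)) *
          (-(κ n * b2 ^ 2) * Y (n + 2) t + F n * L ^ 2 * (Y (n + 1) t ^ 2 - p * Y (n + 2) t * Y (n + 3) t)) +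
        dg k 3 (vec4 (Y n t) (Y (n + 1) t) (Y (n + 2) t) (Y (n + 3) t)) *
          (-(κ n * b2 ^ 3) * Y (n + 3) t + F n * L ^ 3 * (Y (n + 2) t ^ 2 - p * Y (n + 3) t * Y (n + 4) t)) =
        F n * (dg k 0 (vec4 (Y n t) (Y (n + 1) t) (Y (n + 2) t) (Y (n + 3) t)) *
            (fd n t ^ 2 - p * Y n t * Y (n + 1) t) +
          dg k 1 (vec4 (Y n t) (Y (n + 1) t) (Y (n + 2) t) (Y (n + 3) t)) *
            (L * (Y n t ^ 2 - p * Y (n + 1) t * Y (n + 2) t)) +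
          dg k 2 (vec4 (Y n t) (Y (n + 1) t) (Y (n + 2) t) (Y (n + 3) t)) *
            (L ^ 2 * (Y (n + 1) t ^ 2 - p * Y (n + 2) t * Y (n + 3) t)) +
          dg k 3 (vec4 (Y n t) (Y (n + 1) t) (Y (n + 2) t) (Y (n + 3) t)) *
            (L ^ 3 * (Y (n + 2) t ^ 2 - p * Y (n + 3) t * Y (n + 4) t))) -
        κ n * (dg k 0 (vec4 (Y n t) (Y (n + 1) t) (Y (n + 2) t) (Y (n + 3) t)) * Y n t +
          dg k 1 (vec4 (Y n t) (Y (n + 1) t) (Y (n + 2) t) (Y (n + 3) t)) * (b2 * Y (n + 1) t) +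
          dg k 2 (vec4 (Y n t) (Y (n + 1) t) (Y (n + 2) t) (Y (n + 3) t)) * (b2 ^ 2 * Y (n + 2) t) +
          dg k 3 (vec4 (Y n t) (Y (n + 1) t) (Y (n + 2) t) (Y (n + 3) t)) * (b2 ^ 3 * Y (n + 3) t)) := by
      ring
    rw [key]
    have hneg := mul_neg_of_pos_of_neg hFn hQ
    have hdmp := mul_nonneg hκn hSt
    linarith
  -- initially every window is in `Ω`
  have h0 : ∀ nk, h nk 0 ≤ (fun _ => (0:ℝ)) nk := by
    rintro ⟨n, k⟩
    have h00 : (0:ℝ) ∈ Icc 0 s := ⟨le_rfl, hs.le⟩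
    obtain ⟨-, hg⟩ := hbox (W n 0) (hWnn n 0 h00) (fun i => by
      fin_cases i
      · exact hinit _
      · exact hinit _
      · exact hinit _
      · exact hinit _)
    exact hg k
  -- the first-exit lemma over the finite family
  have hall := forall_le_of_hasDerivWithinAt_Ici_of_active_lt (T := s) hcontF hderF hface h0
  -- conclusion: every shell `≤ c`
  intro n t ht
  exact hYc t ht (hall t ht) n

end Summit.NavierStokesRegularity.NavierStokesRegularity.Theorems.VirtualFloor

end
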